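import Summits.ResolutionOfSingularities.ResolutionOfSingularities.Theses.WildQuotients
import Summits.ResolutionOfSingularities.ResolutionOfSingularities.Theorems.WildQuotientsGaloisQuotientAlterationRadicial
import Literature.AlgebraicGeometry.Resolution.GaloisAlterationsQuasiProjective
import Literature.AlgebraicGeometry.RelativeSpec.FiniteGroupQuotientGluedProperties
import Literature.AlgebraicGeometry.RelativeSpec.FiniteGroupQuotientGenericEtale
import HarnessLib

/-!
# WildQuotients / `GaloisQuotientAlteration` (item stmt-ResolutionOfSingularities-16323)

The support item `GaloisQuotientAlteration` of route `ResolutionOfSingularities/WildQuotients` is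
de Jong's theorem (de Jong 1997, Thm. 5.13 / Cor. 5.15; de Jong 1996, Thm. 7.3;
Abramovich–Oort 2000, Thm. 2.8 / Cor. 2.9) read through the quotient of a scheme by a finite
group (SGA 1, Exp. V, §1–2; Mumford, *Abelian Varieties*, §7): every integral separated `X` of
finite type over a field `k` of characteristic `p` admits a regular integral `X'` with a finite
group `G` acting, a finite surjective generically étale `G`-invariant `q : X' → X₁` with fibres
the `G`-orbits onto an integral separated finite-type `X₁`, and `φ : X₁ → X` proper, surjective,
finite and universally injective over a dense open.

This file proves it CONDITIONALLY on the named fact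
`Literature.AlgebraicGeometry.Resolution.DeJong1997_galoisAlterationQuasiProjective` (de Jong's
Galois alteration `π : X' → X` with regular quasi-projective source, faithful `G`, and
`K(X) ⊂ K(X')^G` purely inseparable) — `galoisQuotientAlteration_of_deJong1997` — with ALL the
quotient glue proved in tree:

* `X₁ := X'/G`, the glued quotient over `Spec k` (`…RelativeSpec.FiniteGroupQuotientGluing`:
  it exists because every finite subset, in particular every orbit, of `X'` lies in an affine
  open; `q` is affine, surjective, `G`-invariant with fibres the orbits, and a categorical
  quotient, whence `φ` with `q ≫ φ = π`);
* `X₁` integral, `X₁ → Spec k` of finite type (E. Noether / Artin–Tate), `q` finite, `φ` proper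
  and surjective (`…RelativeSpec.FiniteGroupQuotientGluedProperties`);
* `q` étale over a non-empty open: the action is faithful on `K(X')`, so over a `G`-stable affine
  on which all `g • b - b` needed are units the quotient map is a Chase–Harrison–Rosenberg torsor,
  hence étale by étale descent (`…RelativeSpec.FiniteGroupQuotientGenericEtale`,
  `…RelativeSpec.FreeQuotientEtale`, `…GaloisAlgebras.ChaseHarrisonRosenbergEtale`);
* `φ` finite over a neighbourhood of the generic point (its fibre there is finite: Zariski's Main
  Theorem in the form Mathlib `exists_isFinite_morphismRestrict_of_finite_preimage_singleton`)
  and universally injective over a smaller one, because `K(X₁) ⊂ K(X')^G` is purely inseparable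
  over `K(X)` by (d) (`…Theorems.WildQuotientsGaloisQuotientAlterationRadicial`).

The item therefore hinges on the single named fact `DeJong1997_galoisAlterationQuasiProjective`
(de Jong's theorem itself, XL).
-/

noncomputable section

set_option linter.dupNamespace false -- mandated namespace of this single-conjunct summit

namespace Summit.ResolutionOfSingularities.ResolutionOfSingularities.Theorems

open CategoryTheory Limits AlgebraicGeometry TopologicalSpace
open Literature.AlgebraicGeometry.Resolution Literature.AlgebraicGeometry.RelativeSpec
open Literature.AlgebraicGeometry.Motives Literature.AlgebraicGeometry.Motives.RatFn

/-- **`GaloisQuotientAlteration` from de Jong's Galois alteration theorem** (de Jong 1997,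
Thm. 5.13 / Cor. 5.15 in the form `DeJong1997_galoisAlterationQuasiProjective`) **and the theory
of quotients of schemes by finite groups** (SGA 1, V, §1–2; Mumford AV §7), all of the latter
proved in tree: `X₁ := X'/G` with `q : X' → X'/G` and `φ : X'/G → X` induced by `π`.
CONDITIONAL on the named fact `DeJong1997_galoisAlterationQuasiProjective` only. -/
theorem galoisQuotientAlteration_of_deJong1997
    (hdJ : DeJong1997_galoisAlterationQuasiProjective.{0}) :
    Summit.ResolutionOfSingularities.ResolutionOfSingularities.Theses.WildQuotients.GaloisQuotientAlteration := by
  intro p hp k _ _ X f hsep hlft hqc hint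
  classical
  haveI := hsep; haveI := hlft; haveI := hqc; haveI := hint
  haveI : Fact p.Prime := ⟨hp⟩
  obtain ⟨G, _, _, X', _, ρ, π, _, hπ, hreg, hρinj, hinv, hfinaff, hd⟩ := hdJ k X f hsep hlft hqc
  haveI : Fintype G := Fintype.ofFinite G
  haveI := hπ.isProper
  haveI : Surjective π := hπ.surjective
  haveI : X.IsSeparated := ⟨by rw [← terminal.comp_from f]; infer_instance⟩
  -- the action over `Spec k` and the covering by `G`-stable affine opens
  let r : X' ⟶ Spec (.of k) := π ≫ f
  let ρA : ActionOver r G := ⟨ρ, fun g => by rw [← Category.assoc, hinv g]⟩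
  haveI : IsSeparated r := inferInstanceAs (IsSeparated (π ≫ f))
  haveI : LocallyOfFiniteType r := inferInstanceAs (LocallyOfFiniteType (π ≫ f))
  haveI : QuasiCompact r := inferInstanceAs (QuasiCompact (π ≫ f))
  haveI : X'.IsSeparated := ⟨by rw [← terminal.comp_from r]; infer_instance⟩
  have hcov : ∀ x : X', ∃ O : ρA.StableAffineOpens, x ∈ O.1 := by
    intro x
    obtain ⟨U, hU, hS⟩ := hfinaff (Finset.univ.image fun g : G => (ρ g).hom x)
    obtain ⟨O, hx, -⟩ := ρA.exists_stableAffineOpen_le_of_orbit x U hU fun g => hS (by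
      simp only [Finset.coe_image, Finset.coe_univ, Set.image_univ, Set.mem_range]
      exact ⟨g, rfl⟩)
    exact ⟨O, hx⟩
  -- the quotient `X₁ := X'/G`, `q : X' → X₁`, `φ : X₁ → X`
  have hinv' : ∀ g : G, (ρA.aut g).hom ≫ π = π := hinv
  let q : X' ⟶ ρA.glued := ρA.gluedMk hcov
  let φ : ρA.glued ⟶ X := ρA.gluedDesc π hinv'
  have hqφ : q ≫ φ = π := ρA.gluedMk_gluedDesc hcov π hinv'
  have hφf : φ ≫ f = ρA.gluedDesc r ρA.aut_comp :=
    ρA.glued_hom_ext hcov (by rw [ρA.gluedMk_gluedDesc_assoc, ρA.gluedMk_gluedDesc])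
  haveI : IsIntegral ρA.glued := ρA.isIntegral_glued hcov
  haveI : IsProper φ := ρA.isProper_gluedDesc hcov π hinv' f rfl
  haveI : Surjective φ := ρA.surjective_gluedDesc hcov π hinv'
  haveI : IsFinite q := ρA.isFinite_gluedMk hcov
  haveI : IsSeparated φ := inferInstance
  -- characteristic `p` of `K(X)`
  haveI : CharP X.functionField p := by
    haveI : Nonempty (⊤ : X.Opens) := ⟨⟨genericPoint X, trivial⟩⟩
    exact (((X.germToFunctionField ⊤).hom.comp
      ((f.appTop).hom.comp (Scheme.ΓSpecIso (.of k)).inv.hom)).charP_iff_charP p).mp inferInstance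
  haveI : ExpChar X.functionField p := ExpChar.prime hp
  refine ⟨X', ρA.glued, q, φ, G, inferInstance, inferInstance, ρ, ?_, ?_, ?_, inferInstance,
    inferInstance, hreg, inferInstance, ρA.gluedMk_surjective hcov, ?_, ρA.aut_hom_gluedMk hcov,
    fun x y hxy => ρA.exists_aut_apply_eq_of_gluedMk_eq hcov hxy, inferInstance,
    Scheme.Hom.surjective φ, ?_⟩
  · -- separated over `k`
    infer_instance
  · -- locally of finite type over `k` (E. Noether)
    rw [hφf]; exact ρA.locallyOfFiniteType_gluedDesc_base
  · -- quasi-compact over `k`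
    rw [hφf]; exact ρA.quasiCompact_gluedDesc_base hcov
  · -- `q` is étale over a dense open: the action is faithful on `K(X')`
    have hfaith : ∀ g : G, g ≠ 1 → functionFieldMap (ρA.aut g).hom ≠ RingHom.id _ :=
      ρA.functionFieldMap_ne_id_of_injective hρinj
    obtain ⟨U, hUne, hU⟩ := ρA.exists_etale_morphismRestrict_gluedMk hcov hfaith
    exact ⟨U, U.isOpen.dense hUne, hU⟩
  · -- `φ` is finite and universally injective over a dense open
    -- (1) finite over a neighbourhood of the generic point `η`: the fibre of `φ` over `η` is finite
    obtain ⟨U₀, hU₀ne, hU₀fin⟩ := hπ.exists_isFinite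
    haveI := hU₀fin
    have hη₀ : genericPoint X ∈ U₀ :=
      ((genericPoint_spec X).mem_open_set_iff U₀.isOpen).mpr (by simpa using hU₀ne)
    have hfib : (φ ⁻¹' {genericPoint X}).Finite := by
      refine ((finite_preimage_singleton_of_isFinite_morphismRestrict π U₀ hη₀).image q).subset ?_
      intro y hy
      obtain ⟨x, rfl⟩ := ρA.gluedMk_surjective hcov y
      refine ⟨x, ?_, rfl⟩
      change π x = genericPoint X
      rw [← hqφ]
      exact hy
    obtain ⟨V₀, hηV₀, hV₀fin⟩ :=
      exists_isFinite_morphismRestrict_of_finite_preimage_singleton φ (genericPoint X) hfib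
    obtain ⟨V₁, hV₁aff, hηV₁, hV₁V₀⟩ := exists_isAffineOpen_mem_and_subset hηV₀
    haveI : IsFinite (φ ∣_ V₁) := morphismRestrict_of_le φ (fun x hx => hV₁V₀ hx) hV₀fin
    -- (2) `K(X₁)/K(X)` is purely inseparable: `K(X₁) ⊆ K(X')^G` via `q♯`, and (d)
    have hpi : ∀ b : (ρA.glued).functionField, ∃ (n : ℕ) (c : X.functionField),
        b ^ p ^ n = functionFieldMap φ c := by
      intro b
      have hfix : ∀ g : G, functionFieldMap (ρ g).hom (functionFieldMap q b) = functionFieldMap q b := by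
        intro g
        have key : ∀ (q' : X' ⟶ ρA.glued) [IsDominant q'], q' = q →
            functionFieldMap q' = functionFieldMap q := by
          rintro _ _ rfl; rfl
        have e : functionFieldMap ((ρ g).hom ≫ q) = (functionFieldMap (ρ g).hom).comp
            (functionFieldMap q) := functionFieldMap_comp q (ρ g).hom
        rw [← RingHom.comp_apply, ← e, key ((ρ g).hom ≫ q) (ρA.aut_hom_gluedMk hcov g)]
      obtain ⟨n, hn⟩ := hd (functionFieldMap q b) hfix
      rw [ringExpChar.eq X.functionField p] at hn
      obtain ⟨c, hc⟩ := hn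
      refine ⟨n, c, ?_⟩
      apply (functionFieldMap q).injective
      have key : ∀ (π' : X' ⟶ X) [IsDominant π'], π' = π →
          functionFieldMap π' = functionFieldMap π := by
        rintro _ _ rfl; rfl
      rw [map_pow, ← hc, ← key (q ≫ φ) hqφ, functionFieldMap_comp φ q, RingHom.comp_apply]
    -- (3) radicial over a smaller open
    obtain ⟨V, hηV, -, hVfin, hVui⟩ :=
      exists_isFinite_universallyInjective_morphismRestrict φ hp hV₁aff hηV₁ hpi
    exact ⟨V, V.isOpen.dense ⟨_, hηV⟩, hVfin, hVui⟩

end Summit.ResolutionOfSingularities.ResolutionOfSingularities.Theorems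

end
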